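import Literature.Probability.LatticeModels.SubcriticalFourier
import HarnessLib

/-!
# A discrete Parseval identity: lattice sums against trigonometric polynomials through a momentum grid

Topic `Literature/Probability/LatticeModels` (harmonic-analysis toolkit for the sliding-scale
infrared bound); family `crit-ising`. No named fact, no sorry; one definition, `periodize`
(`S_Λ(x) = ∑_{w ∈ ℤ^d} S(x + Λw)`).

The proof of Aizenman–Duminil-Copin 2021, Thm 5.6 (arXiv:1912.07973 p. 19–20) compares box sums
`χ_L = ∑_{Λ_L} S` of the two-point function with momentum averages of `Ŝ`. The tree's version avoids
integration over the Brillouin zone: it evaluates `Ŝ` on the finite momentum grid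
`p_k = 2πk/Λ`, `k ∈ (ℤ/Λℤ)^d`, and lets `Λ → ∞` at the end. This file supplies the two facts that
make the grid a faithful substitute:

* `discreteParseval` — for an even `F` (summed over a box) and a nonnegative summable `S`,
  `∑_k F̂(p_k) Ŝ(p_k) = Λ^d ∑_x F(x) S_Λ(x)`, where `F̂`, `Ŝ` are the cosine transforms and `S_Λ` the
  periodization (orthogonality of the grid characters, `sum_cos_phase_latticeMomentum`, from the
  tree's `sum_torusChar_left`; the terms `x ≡ -y` are folded in by evenness);
* `le_periodize`, `tendsto_periodize` — `S ≤ S_Λ` and `S_Λ(x) → S(x)` as `Λ → ∞` (the other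
  translates leave every box; tails of a summable function, `tendsto_tsum_compl_atTop_zero`).

## References

* M. Aizenman, H. Duminil-Copin, Ann. of Math. 194 (2021) = arXiv:1912.07973, proof of Thm 5.6
  (p. 19–20) [AizenmanDuminilCopinAnnals2021].
* S. Friedli, Y. Velenik (2017), §10.4 (characters of the discrete torus) [FriedliVelenik2017].

## Mathlib

`tendsto_tsum_compl_atTop_zero`, `Monotone.tendsto_atTop_finset`, `Summable.tsum_le_tsum_of_inj`,
`Function.Injective.tsum_eq`, `Summable.tsum_eq_add_tsum_ite`, `Summable.tsum_finsetSum`.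
-/

noncomputable section

open Finset Complex Filter Topology
open scoped ComplexConjugate

namespace Literature.Probability.LatticeModels

variable {d : ℕ}

/-! ### Part 1. Character sums over the momentum grid -/

section Grid

variable {Λ : ℕ} [NeZero Λ]

/-- `cos(p_k · z) = Re χ_k(z̄)` for the grid momentum `p_k = 2πk/Λ`. [folklore] -/
theorem cos_phase_latticeMomentum (k : TorusSite d Λ) (z : Site d) :
    Real.cos (phase d (latticeMomentum Λ k) z) = (torusChar k (Torus.proj Λ z)).re := by
  rw [torusChar_re, cos_latticeMomentum_val_proj_eq]

omit [NeZero Λ] in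
/-- `z̄ = 0` in `(ℤ/Λℤ)^d` iff `z ∈ Λℤ^d`. [folklore] -/
theorem torusProj_eq_zero_iff (z : Site d) : Torus.proj Λ z = 0 ↔ ∃ w : Site d, z = (Λ : ℤ) • w := by
  constructor
  · intro h
    have hz : ∀ i, (Λ : ℤ) ∣ z i := fun i => by
      have := congrFun h i
      rw [Torus.proj_apply] at this
      exact (ZMod.intCast_zmod_eq_zero_iff_dvd _ _).1 this
    choose w hw using hz
    exact ⟨w, funext fun i => by rw [Pi.smul_apply, smul_eq_mul, hw i]⟩
  · rintro ⟨w, rfl⟩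
    funext i
    rw [Torus.proj_apply]
    simp

/-- **Orthogonality on the momentum grid**: `∑_{k ∈ (ℤ/Λℤ)^d} cos(p_k · z) = Λ^d 𝟙{z ∈ Λℤ^d}`. [folklore] -/
theorem sum_cos_phase_latticeMomentum (z : Site d) :
    ∑ k : TorusSite d Λ, Real.cos (phase d (latticeMomentum Λ k) z) =
      if Torus.proj Λ z = 0 then (Λ : ℝ) ^ d else 0 := by
  rw [Finset.sum_congr rfl fun k _ => cos_phase_latticeMomentum k z, ← Complex.re_sum, sum_torusChar_left]
  split_ifs
  · rw [show ((Λ : ℂ) ^ d) = (((Λ : ℝ) ^ d : ℝ) : ℂ) by push_cast; rfl, Complex.ofReal_re]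
  · simp

end Grid

/-! ### Part 2. Periodization -/

section Periodization

variable (d) in
/-- The **periodization** `S_Λ(x) = ∑_{w ∈ ℤ^d} S(x + Λw)` of a function on `ℤ^d`. [folklore] -/
def periodize (Λ : ℕ) (S : Site d → ℝ) (x : Site d) : ℝ := ∑' w : Site d, S (x + (Λ : ℤ) • w)

/-- `w ↦ x + Λw` is injective (`Λ ≥ 1`). [folklore] -/
theorem injective_add_smul {Λ : ℕ} (hΛ : 1 ≤ Λ) (x : Site d) : Function.Injective fun w : Site d => x + (Λ : ℤ) • w := by
  intro w w' h
  have h' : (Λ : ℤ) • w = (Λ : ℤ) • w' := add_left_cancel h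
  funext i
  have := congrFun h' i
  simp only [Pi.smul_apply, smul_eq_mul] at this
  exact mul_left_cancel₀ (by exact_mod_cast (show Λ ≠ 0 by omega)) this

/-- Summability of the periodization terms. [folklore] -/
theorem summable_comp_add_smul {Λ : ℕ} (hΛ : 1 ≤ Λ) {S : Site d → ℝ} (hS : Summable S) (x : Site d) :
    Summable fun w : Site d => S (x + (Λ : ℤ) • w) :=
  hS.comp_injective (injective_add_smul hΛ x)

/-- **`S_Λ ≥ S`** for `S ≥ 0` summable. [folklore] -/
theorem le_periodize {Λ : ℕ} (hΛ : 1 ≤ Λ) {S : Site d → ℝ} (hS : Summable S) (h0 : ∀ y, 0 ≤ S y) (x : Site d) :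
    S x ≤ periodize d Λ S x := by
  classical
  unfold periodize
  rw [(summable_comp_add_smul hΛ hS x).tsum_eq_add_tsum_ite 0]
  simp only [smul_zero, add_zero]
  refine le_add_of_nonneg_right (tsum_nonneg fun w => ?_)
  split_ifs
  · exact le_rfl
  · exact h0 _

/-- Decomposition `S_Λ(x) = S(x) + ∑_{w ≠ 0} S(x + Λw)`. [folklore] -/
theorem periodize_eq_add {Λ : ℕ} (hΛ : 1 ≤ Λ) {S : Site d → ℝ} (hS : Summable S) (x : Site d) :
    periodize d Λ S x = S x + ∑' w : Site d, (if w = 0 then 0 else S (x + (Λ : ℤ) • w)) := by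
  classical
  unfold periodize
  rw [(summable_comp_add_smul hΛ hS x).tsum_eq_add_tsum_ite 0]
  simp only [smul_zero, add_zero]

/-- A nonzero translate `x + Λw` leaves the box of radius `Λ - ‖x‖ - 1` once `Λ > ‖x‖`. [folklore] -/
theorem add_smul_not_mem_box {Λ : ℕ} {x w : Site d} (hΛ : Site.supNorm x < Λ) (hw : w ≠ 0) :
    x + (Λ : ℤ) • w ∉ box d (Λ - Site.supNorm x - 1) := by
  obtain ⟨i, hi⟩ : ∃ i, w i ≠ 0 := by
    by_contra h
    push Not at h
    exact hw (funext h)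
  rw [mem_box]
  push Not
  refine ⟨i, ?_⟩
  simp only [Pi.add_apply, Pi.smul_apply, smul_eq_mul]
  have hxi : ((x i).natAbs : ℤ) ≤ Site.supNorm x := by exact_mod_cast Site.natAbs_le_supNorm x i
  rw [Int.natCast_natAbs] at hxi
  have h1 : (1 : ℤ) ≤ |w i| := Int.one_le_abs hi
  have hΛ' : (Site.supNorm x : ℤ) < Λ := by exact_mod_cast hΛ
  have hsub : ((Λ - Site.supNorm x - 1 : ℕ) : ℤ) = Λ - Site.supNorm x - 1 := by omega
  intro hle
  rw [hsub] at hle ⊢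
  by_contra hle2
  push Not at hle2
  -- `|x i + Λ w i| ≥ Λ |w i| - |x i| ≥ Λ - ‖x‖`
  have habs : (Λ : ℤ) * |w i| - |x i| ≤ |x i + Λ * w i| := by
    have := abs_add_le (x i + Λ * w i) (-(x i))
    rw [add_neg_cancel_comm, abs_neg, abs_mul, Nat.abs_cast] at this
    linarith
  have hle' : |x i + (Λ : ℤ) * w i| ≤ Λ - Site.supNorm x - 1 := abs_le.2 ⟨hle, hle2⟩
  nlinarith

/-- **`S_Λ(x) → S(x)` as `Λ → ∞`** for `S ≥ 0` summable (the other translates escape every box). [folklore] -/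
theorem tendsto_periodize {S : Site d → ℝ} (hS : Summable S) (h0 : ∀ y, 0 ≤ S y) (x : Site d) :
    Tendsto (fun Λ : ℕ => periodize d Λ S x) atTop (𝓝 (S x)) := by
  classical
  -- the tail functional `τ(n) = ∑_{y ∉ Λ_n} S(y) → 0`
  set τ : ℕ → ℝ := fun n => ∑' y : Site d, (↑(box d n) : Set (Site d))ᶜ.indicator S y with hτ
  have hτ0 : Tendsto τ atTop (𝓝 0) := by
    have h1 := tendsto_tsum_compl_atTop_zero S
    have h2 : Tendsto (fun n : ℕ => box d n) atTop atTop :=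
      Monotone.tendsto_atTop_finset (fun m n hmn => box_mono d hmn) fun y =>
        ⟨Site.supNorm y, by rw [mem_box]; intro i; have := Site.natAbs_le_supNorm y i; constructor <;> omega⟩
    refine (h1.comp h2).congr fun n => ?_
    simp only [Function.comp_apply, hτ]
    rw [← _root_.tsum_subtype]
    rfl
  have hτ' : Tendsto (fun Λ : ℕ => S x + τ (Λ - Site.supNorm x - 1)) atTop (𝓝 (S x)) := by
    have : Tendsto (fun Λ : ℕ => τ (Λ - Site.supNorm x - 1)) atTop (𝓝 0) := by
      refine hτ0.comp ?_
      refine tendsto_atTop_atTop.2 fun n => ⟨n + Site.supNorm x + 1, fun Λ hΛ => ?_⟩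
      omega
    simpa using this.const_add (S x)
  refine tendsto_of_tendsto_of_tendsto_of_le_of_le' tendsto_const_nhds hτ' ?_ ?_
  · filter_upwards [eventually_ge_atTop 1] with Λ hΛ
    exact le_periodize hΛ hS h0 x
  · filter_upwards [eventually_gt_atTop (Site.supNorm x)] with Λ hΛ
    have hΛ1 : 1 ≤ Λ := by omega
    rw [periodize_eq_add hΛ1 hS x]
    gcongr
    -- inject `w ↦ x + Λ w` (the `w = 0` term is `0`)
    have hg : Summable fun y : Site d => (↑(box d (Λ - Site.supNorm x - 1)) : Set (Site d))ᶜ.indicator S y :=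
      hS.indicator _
    have hf : Summable fun w : Site d => if w = 0 then 0 else S (x + (Λ : ℤ) • w) := by
      refine (summable_comp_add_smul hΛ1 hS x).of_nonneg_of_le (fun w => ?_) (fun w => ?_)
      · split_ifs; exact le_rfl; exact h0 _
      · split_ifs; exact h0 _; exact le_rfl
    refine Summable.tsum_le_tsum_of_inj (fun w : Site d => x + (Λ : ℤ) • w) (injective_add_smul hΛ1 x)
      (fun c _ => Set.indicator_nonneg (fun y _ => h0 y) c) (fun w => ?_) hf hg
    split_ifs with hw
    · exact Set.indicator_nonneg (fun y _ => h0 y) _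
    · rw [Set.indicator_of_mem]
      exact add_smul_not_mem_box hΛ hw

end Periodization

/-! ### Part 3. The discrete Parseval identity -/

section Parseval

variable {Λ : ℕ} [NeZero Λ]

/-- `p·(x - y) = p·x - p·y`. [folklore] -/
theorem phase_sub (p : Fin d → ℝ) (x y : Site d) : phase d p (x - y) = phase d p x - phase d p y := by
  rw [sub_eq_add_neg, phase_add, phase_neg, ← sub_eq_add_neg]

/-- **Product of grid cosines, summed over the grid**:
`∑_k cos(p_k·x) cos(p_k·y) = (Λ^d/2)(𝟙{x ≡ y} + 𝟙{x ≡ -y})` (congruences mod `Λℤ^d`). [folklore] -/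
theorem sum_cos_mul_cos_latticeMomentum (x y : Site d) :
    ∑ k : TorusSite d Λ, Real.cos (phase d (latticeMomentum Λ k) x) * Real.cos (phase d (latticeMomentum Λ k) y) =
      (Λ : ℝ) ^ d / 2 * ((if Torus.proj Λ (x - y) = 0 then 1 else 0) + (if Torus.proj Λ (x + y) = 0 then 1 else 0)) := by
  have hpt : ∀ k : TorusSite d Λ, Real.cos (phase d (latticeMomentum Λ k) x) * Real.cos (phase d (latticeMomentum Λ k) y) =
      (Real.cos (phase d (latticeMomentum Λ k) (x - y)) + Real.cos (phase d (latticeMomentum Λ k) (x + y))) / 2 := by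
    intro k
    rw [phase_sub, phase_add, Real.cos_sub, Real.cos_add]
    ring
  simp only [hpt, ← Finset.sum_div, Finset.sum_add_distrib, sum_cos_phase_latticeMomentum]
  split_ifs <;> ring

omit [NeZero Λ] in
/-- The translates of `x` by `Λℤ^d` as an indicator: `𝟙{x̄ - ȳ = 0} S(y) = 𝟙_{x + Λℤ^d}(y) S(y)`. [folklore] -/
theorem ite_torusProj_sub_eq_indicator (S : Site d → ℝ) (x y : Site d) :
    (if Torus.proj Λ (x - y) = 0 then S y else 0) = (Set.range fun w : Site d => x + (Λ : ℤ) • w).indicator S y := by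
  by_cases h : Torus.proj Λ (x - y) = 0
  · rw [if_pos h, Set.indicator_of_mem]
    obtain ⟨w, hw⟩ := (torusProj_eq_zero_iff _).1 h
    refine ⟨-w, ?_⟩
    show x + (Λ : ℤ) • (-w) = y
    have : y = x - (Λ : ℤ) • w := by rw [← hw]; abel
    rw [this, smul_neg, sub_eq_add_neg]
  · rw [if_neg h, Set.indicator_of_notMem]
    rintro ⟨w, rfl⟩
    apply h
    rw [torusProj_eq_zero_iff]
    refine ⟨-w, ?_⟩
    show x - (x + (Λ : ℤ) • w) = (Λ : ℤ) • (-w)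
    rw [smul_neg]
    abel

omit [NeZero Λ] in
/-- `∑_y 𝟙{x̄ = ȳ} S(y) = S_Λ(x)`. [folklore] -/
theorem tsum_ite_torusProj_sub_eq_periodize (hΛ : 1 ≤ Λ) (S : Site d → ℝ) (x : Site d) :
    ∑' y : Site d, (if Torus.proj Λ (x - y) = 0 then S y else 0) = periodize d Λ S x := by
  simp only [ite_torusProj_sub_eq_indicator]
  have hsupp : Function.support ((Set.range fun w : Site d => x + (Λ : ℤ) • w).indicator S) ⊆
      Set.range fun w : Site d => x + (Λ : ℤ) • w := Set.support_indicator_subset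
  rw [← (injective_add_smul hΛ x).tsum_eq hsupp]
  unfold periodize
  refine tsum_congr fun w => ?_
  exact Set.indicator_of_mem (Set.mem_range_self w) S

omit [NeZero Λ] in
/-- `∑_y 𝟙{x̄ = -ȳ} S(y) = S_Λ(-x)`. [folklore] -/
theorem tsum_ite_torusProj_add_eq_periodize (hΛ : 1 ≤ Λ) (S : Site d → ℝ) (x : Site d) :
    ∑' y : Site d, (if Torus.proj Λ (x + y) = 0 then S y else 0) = periodize d Λ S (-x) := by
  rw [← tsum_ite_torusProj_sub_eq_periodize hΛ S (-x)]
  refine tsum_congr fun y => ?_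
  have : Torus.proj Λ (-x - y) = -Torus.proj Λ (x + y) := by
    rw [show -x - y = -(x + y) by abel]
    funext i; simp [Torus.proj_apply]
  simp only [this, neg_eq_zero]

omit [NeZero Λ] in
/-- Boxes are symmetric. [folklore] -/
theorem neg_mem_box {L : ℕ} {x : Site d} (hx : x ∈ box d L) : -x ∈ box d L := by
  rw [mem_box] at hx ⊢
  intro i
  have := hx i
  simp only [Pi.neg_apply]
  omega

/-- **The discrete Parseval identity** for an even function `F` supported in `Λ_{L₀}` and a
nonnegative summable `S`: with `F̂(p) = ∑_x F(x) cos(p·x)`, `Ŝ(p) = ∑_y S(y) cos(p·y)` and the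
momentum grid `p_k = 2πk/Λ`, `k ∈ (ℤ/Λℤ)^d`,
`∑_k F̂(p_k) Ŝ(p_k) = Λ^d ∑_x F(x) S_Λ(x)`, `S_Λ` the periodization. (Orthogonality of the grid
characters; the `x ≡ -y` terms are folded in by the evenness of `F`.) [folklore] -/
theorem discreteParseval (hΛ : 1 ≤ Λ) {L₀ : ℕ} {F : Site d → ℝ} (hFeven : ∀ x, F (-x) = F x)
    {S : Site d → ℝ} (hS : Summable S) (hS0 : ∀ y, 0 ≤ S y) :
    ∑ k : TorusSite d Λ, (∑ x ∈ box d L₀, F x * Real.cos (phase d (latticeMomentum Λ k) x)) *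
        (∑' y : Site d, S y * Real.cos (phase d (latticeMomentum Λ k) y)) =
      (Λ : ℝ) ^ d * ∑ x ∈ box d L₀, F x * periodize d Λ S x := by
  classical
  -- summability of the pieces
  have hSc : ∀ k : TorusSite d Λ, Summable fun y : Site d => S y * Real.cos (phase d (latticeMomentum Λ k) y) := fun k =>
    hS.of_norm_bounded fun y => by
      rw [Real.norm_eq_abs, abs_mul, abs_of_nonneg (hS0 y)]
      exact mul_le_of_le_one_right (hS0 y) (Real.abs_cos_le_one _)
  have hA : ∀ x : Site d, Summable fun y : Site d => if Torus.proj Λ (x - y) = 0 then S y else 0 := fun x =>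
    hS.of_nonneg_of_le (fun y => by split_ifs; exact hS0 y; exact le_rfl) (fun y => by split_ifs; exact le_rfl; exact hS0 y)
  have hB : ∀ x : Site d, Summable fun y : Site d => if Torus.proj Λ (x + y) = 0 then S y else 0 := fun x =>
    hS.of_nonneg_of_le (fun y => by split_ifs; exact hS0 y; exact le_rfl) (fun y => by split_ifs; exact le_rfl; exact hS0 y)
  -- expand and exchange the finite sums with the `y`-series
  calc ∑ k : TorusSite d Λ, (∑ x ∈ box d L₀, F x * Real.cos (phase d (latticeMomentum Λ k) x)) *
        (∑' y : Site d, S y * Real.cos (phase d (latticeMomentum Λ k) y))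
      = ∑ k : TorusSite d Λ, ∑ x ∈ box d L₀, ∑' y : Site d,
          F x * S y * (Real.cos (phase d (latticeMomentum Λ k) x) * Real.cos (phase d (latticeMomentum Λ k) y)) := by
        refine Finset.sum_congr rfl fun k _ => ?_
        rw [Finset.sum_mul]
        refine Finset.sum_congr rfl fun x _ => ?_
        rw [← tsum_mul_left]
        exact tsum_congr fun y => by ring
    _ = ∑ x ∈ box d L₀, ∑' y : Site d, ∑ k : TorusSite d Λ,
          F x * S y * (Real.cos (phase d (latticeMomentum Λ k) x) * Real.cos (phase d (latticeMomentum Λ k) y)) := by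
        rw [Finset.sum_comm]
        refine Finset.sum_congr rfl fun x _ => ?_
        rw [Summable.tsum_finsetSum]
        intro k _
        exact ((hSc k).mul_left (F x * Real.cos (phase d (latticeMomentum Λ k) x))).congr fun y => by ring
    _ = ∑ x ∈ box d L₀, F x * ((Λ : ℝ) ^ d / 2) *
          ((∑' y : Site d, if Torus.proj Λ (x - y) = 0 then S y else 0) +
            ∑' y : Site d, if Torus.proj Λ (x + y) = 0 then S y else 0) := by
        refine Finset.sum_congr rfl fun x _ => ?_
        rw [← (hA x).tsum_add (hB x), ← tsum_mul_left]
        refine tsum_congr fun y => ?_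
        rw [← Finset.mul_sum, sum_cos_mul_cos_latticeMomentum]
        split_ifs <;> ring
    _ = (Λ : ℝ) ^ d / 2 * (∑ x ∈ box d L₀, F x * periodize d Λ S x + ∑ x ∈ box d L₀, F x * periodize d Λ S (-x)) := by
        simp only [tsum_ite_torusProj_sub_eq_periodize hΛ, tsum_ite_torusProj_add_eq_periodize hΛ, Finset.mul_sum,
          ← Finset.sum_add_distrib]
        exact Finset.sum_congr rfl fun x _ => by ring
    _ = (Λ : ℝ) ^ d * ∑ x ∈ box d L₀, F x * periodize d Λ S x := by
        -- fold the second sum by `x ↦ -x` (`F` even, the box symmetric)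
        have : ∑ x ∈ box d L₀, F x * periodize d Λ S (-x) = ∑ x ∈ box d L₀, F x * periodize d Λ S x := by
          refine Finset.sum_nbij' (fun x => -x) (fun x => -x) (fun x hx => neg_mem_box hx) (fun x hx => neg_mem_box hx)
            (fun x _ => neg_neg x) (fun x _ => neg_neg x) fun x _ => ?_
          rw [hFeven]
        rw [this]
        ring

end Parseval

end Literature.Probability.LatticeModels

end
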